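/-
COR-CM (cell pub-hodgecm2) — Δ2 BRIDGE, ADAPTER TRACK (c-S.2): the Def. 4.5 (1) relabel `η_{μᶜ} = c ∘ η_μ` (sequel of
`D2Bridge/AdapterMuConjRelabel.lean`, seat prover-pub-hodgecm2-d2bridge-adapt-3-g0-0).  THEOREMS ONLY; explicit binders; nothing landed is
edited or restated.  HC_CM is NOT proved; «Δ2 BRIDGE CLOSED» is NOT claimed; no pointer moves.
-/
import Literature.NumberTheory.Automorphic.Liu2021.Def45AsPrinted
import Literature.NumberTheory.Automorphic.IdeleClassCharacterConjugateReflex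
import Literature.NumberTheory.Automorphic.IdeleClassCharacterAlgebraicTwist
import Literature.NumberTheory.ComplexMultiplication.ReflexOfConjugateType
import HarnessLib

set_option autoImplicit false

/-!
# Δ2 adapter (c-S.2): `η_{μᶜ} = c_E ∘ η_μ` ([Liu21] Def. 4.5 (1) for the conjugate character)

[Liu2021] Def. 4.5 (1) (TeX l. 1939–1942) puts `η_μ := η'_μ ∘ Nm_{M_μ/M'_μ} : M_μ^× → E^×`, `η'_μ` the reciprocity map (reflex type norm) of
`(E, Φ_μ)`; Remark 4.4 (ll. 1930–1933): `M_{μᶜ} = M_μ`, `M'_{μᶜ} = M'_μ`, `Ψ_{μᶜ}` the opposite type.  Consequence (one checks from the printed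
definition; used when a CM datum `D_μ` is transported to `D_μ^{(c)} = (A_μ ⊗_{E,c} E, …)` for `μᶜ`, Def. 4.5 (2) first bullet):
**`η_{μᶜ}(x) = \overline{η_μ(x)}`** for `x ∈ M_{μᶜ} = M_μ`, `\bar{·} = c_E` the CM involution of `E`.

* `eta_galConj_apply` — in the tree's presentation `(L, φ, ι)` of `Def45AsPrinted`: for `x ∈ ℂ` lying in `M_μ` (hence in `M_{μᶜ}`,
  `muAlgValueField_galConj_complexConj`), `Def45.eta φ ι hμ.galConj ⟨x, _⟩ = IsCMField.complexConj E (Def45.eta φ ι hμ ⟨x, _⟩)`.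
  Proof: read both sides in `ℂ` through `ι ∘ φ` (`Def45.apply_eta_eq_finprod`): the induced type `Ψ̃_{μᶜ}` on `M_{μᶜ} = M_μ` is the conjugate
  of `Ψ̃_μ` (`coe_inducedCMType_galConj_eq_image`: same Galois element `g`, `S*(Φ̄_L) = S*(Φ_L)ᶜ` by `algValuedIn_bar` + `reflexLift_compl`,
  the two presented reflex fields being equal by `reflexField_cmType_galConj`), and the type norm of a conjugate type is the conjugate.

References: [Liu2021] Y. Liu, Camb. J. Math. 9 (2021) = arXiv:2102.11518, Def. 4.5 (1) (l. 1939–1942), Remark 4.4 (ll. 1930–1933);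
[Shimura1998] G. Shimura, *Abelian Varieties with Complex Multiplication and Modular Functions*, §8.3 Prop. 28, §18.5 (18.5b).
-/

noncomputable section

namespace Summit.HodgeConjecture.CorCM.D2Bridge.AdapterRelabel

open NumberField NumberField.ComplexEmbedding
open Literature.AlgebraicGeometry.Motives (CMType)
open Literature.NumberTheory.ComplexMultiplication
open Literature.NumberTheory.ComplexMultiplication.CMTypeOps (bar mem_bar_iff conjugate_mem_iff_notMem)
open Literature.NumberTheory.Automorphic Literature.NumberTheory.Automorphic.IdeleClassGroup
open Literature.NumberTheory.Automorphic.Liu2021 Literature.NumberTheory.Automorphic.Liu2021.Def45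

/-- The type norm of the conjugate type is the complex conjugate of the type norm (adapted from the private lemma of
`Liu2021/Def45EtaConjugate`). [folklore] -/
private theorem finprod_mem_bar_apply {M : Type} [Field M] [NumberField M] (Θ : CMType M) (x : M) :
    ∏ᶠ θ ∈ (bar Θ).1, θ x = starRingEnd ℂ (∏ᶠ θ ∈ Θ.1, θ x) := by
  have himg : (bar Θ).1 = conjugate '' Θ.1 := by
    ext θ
    rw [mem_bar_iff, Set.mem_image]
    constructor
    · intro h
      exact ⟨conjugate θ, (conjugate_mem_iff_notMem Θ θ).mpr h, involutive_conjugate M θ⟩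
    · rintro ⟨θ', hθ', rfl⟩
      exact (Θ.2 θ').mp hθ'
  have hmap := MonoidHom.map_finprod_mem (fun θ : M →+* ℂ => θ x) (starRingEnd ℂ : ℂ →* ℂ) (Set.toFinite Θ.1)
  simp only [MonoidHom.coe_coe] at hmap
  rw [himg, finprod_mem_image (involutive_conjugate M).injective.injOn]
  calc ∏ᶠ θ ∈ Θ.1, (conjugate θ) x = ∏ᶠ θ ∈ Θ.1, starRingEnd ℂ (θ x) :=
        finprod_mem_congr rfl fun θ _ => conjugate_coe_eq θ x
    _ = starRingEnd ℂ (∏ᶠ θ ∈ Θ.1, θ x) := hmap.symm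

/-- Round trip along an equality of subfields (one way). [folklore] -/
private theorem inclusion_ge_inclusion_le {K : Type} [Field K] {A B : Subfield K} (h : A = B) (m : ↥A) :
    Subfield.inclusion h.ge (Subfield.inclusion h.le m) = m := Subtype.ext rfl

/-- Round trip along an equality of subfields (other way). [folklore] -/
private theorem inclusion_le_inclusion_ge {K : Type} [Field K] {A B : Subfield K} (h : A = B) (m : ↥B) :
    Subfield.inclusion h.le (Subfield.inclusion h.ge m) = m := Subtype.ext rfl

/-- The inclusion along an equality of subfields does not move the underlying element. [folklore] -/
private theorem inclusion_mk {K : Type} [Field K] {A B : Subfield K} (h : A ≤ B) (x : K) (hx : x ∈ A) :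
    Subfield.inclusion h ⟨x, hx⟩ = ⟨x, h hx⟩ := rfl

section Eta

variable {E : Type} [Field E] [NumberField E] [IsCMField E]
variable {L : Type} [Field L] [NumberField L] [IsCMField L] [IsGalois ℚ L]

local notation3 "𝔠" => IsCMField.complexConj E

/-- **The induced type of `μᶜ` is the conjugate of the induced type of `μ`, membership form.**  For `θ' : M_{μᶜ} → ℂ` (with
`M_{μᶜ} = M_μ` as subfields of `ℂ`, Rem. 4.4): `θ' ∈ Ψ̃_{μᶜ}` iff `θ' |_{M_μ} ∉ Ψ̃_μ` — both are read on the SAME Galois element `g`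
(`θ'|_{M'} = ι ∘ g|_{K*}`), and `S*(Φ̄_L) = S*(Φ_L)ᶜ`. [cite: Liu2021, Remark 4.4 (TeX ll. 1930–1933)] [cite: Shimura1998, §8.3 Prop. 28] -/
theorem mem_inducedCMType_galConj_iff (φ : E →ₐ[ℚ] L) (ι : L →+* ℂ)
    {μ : Literature.NumberTheory.Automorphic.IdeleClassGroup E →ₜ* Circle} (hμ : IsConjugateSymplectic E μ)
    (θ' : ↥(muAlgValueField E (galConj 𝔠 μ)) →+* ℂ) :
    θ' ∈ (inducedCMType (incl φ ι hμ.galConj) (reflexCMType ι hμ.galConj.cmType φ)).1 ↔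
      θ'.comp (Subfield.inclusion (muAlgValueField_galConj_complexConj μ).ge) ∉
        (inducedCMType (incl φ ι hμ) (reflexCMType ι hμ.cmType φ)).1 := by
  have hK : reflexField ℚ L (algValuedIn ι hμ.galConj.cmType.1) = reflexField ℚ L (algValuedIn ι hμ.cmType.1) :=
    hμ.reflexField_cmType_galConj ι
  rw [mem_inducedCMType_iff, mem_inducedCMType_iff]
  -- present `θ' ∘ incl_{μᶜ} : K*_{μᶜ} → ℂ` as `ι ∘ (g|_{K*_{μᶜ}})`
  obtain ⟨ψ, hψ⟩ := exists_algHom_comp_eq_of_normal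
    (reflexField ℚ L (algValuedIn ι hμ.galConj.cmType.1)).val ι (θ'.comp (incl φ ι hμ.galConj))
  obtain ⟨g, rfl⟩ := exists_algEquiv_smul_eq (reflexField ℚ L (algValuedIn ι hμ.galConj.cmType.1)).val ψ
  -- then `(θ'|_{M_μ}) ∘ incl_μ : K*_μ → ℂ` is `ι ∘ (g|_{K*_μ})` for the SAME `g`
  have hθ : (θ'.comp (Subfield.inclusion (muAlgValueField_galConj_complexConj μ).ge)).comp (incl φ ι hμ) =
      ι.comp ((g • (reflexField ℚ L (algValuedIn ι hμ.cmType.1)).val :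
        reflexField ℚ L (algValuedIn ι hμ.cmType.1) →ₐ[ℚ] L) : _ →+* L) := by
    refine RingHom.ext fun k => ?_
    have hk : (k : L) ∈ reflexField ℚ L (algValuedIn ι hμ.galConj.cmType.1) := by
      rw [hK]
      exact k.2
    have h := RingHom.congr_fun hψ ⟨(k : L), hk⟩
    simp only [RingHom.coe_comp, Function.comp_apply, AlgHom.coe_toRingHom, algEquiv_smul_apply,
      IntermediateField.coe_val] at h ⊢
    have hcast : Subfield.inclusion (muAlgValueField_galConj_complexConj μ).ge (incl φ ι hμ k) =
        incl φ ι hμ.galConj ⟨(k : L), hk⟩ := by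
      apply Subtype.ext
      rw [coe_incl]
      rfl
    rw [hcast]
    exact h.symm
  rw [← hψ, hθ, comp_smul_val_mem_reflexCMType_iff, comp_smul_val_mem_reflexCMType_iff, hμ.cmType_galConj,
    algValuedIn_bar, reflexLift_compl, Set.mem_compl_iff]

/-- **The induced type of `μᶜ` is the image of the conjugate type `\bar Ψ̃_μ` under restriction along `M_{μᶜ} = M_μ`.**
[cite: Liu2021, Remark 4.4 (TeX ll. 1930–1933)] -/
theorem coe_inducedCMType_galConj_eq_image (φ : E →ₐ[ℚ] L) (ι : L →+* ℂ)
    {μ : Literature.NumberTheory.Automorphic.IdeleClassGroup E →ₜ* Circle} (hμ : IsConjugateSymplectic E μ) :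
    (inducedCMType (incl φ ι hμ.galConj) (reflexCMType ι hμ.galConj.cmType φ)).1 =
      (fun θ : ↥(muAlgValueField E μ) →+* ℂ =>
          θ.comp (Subfield.inclusion (muAlgValueField_galConj_complexConj μ).le)) ''
        (bar (inducedCMType (incl φ ι hμ) (reflexCMType ι hμ.cmType φ))).1 := by
  ext θ'
  rw [mem_inducedCMType_galConj_iff φ ι hμ θ', Set.mem_image]
  constructor
  · intro h
    refine ⟨θ'.comp (Subfield.inclusion (muAlgValueField_galConj_complexConj μ).ge), (mem_bar_iff _ _).2 h, ?_⟩
    exact RingHom.ext fun m => by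
      rw [RingHom.comp_apply, RingHom.comp_apply, inclusion_ge_inclusion_le (muAlgValueField_galConj_complexConj μ)]
  · rintro ⟨θ, hθ, rfl⟩
    have hcomp : (θ.comp (Subfield.inclusion (muAlgValueField_galConj_complexConj μ).le)).comp
        (Subfield.inclusion (muAlgValueField_galConj_complexConj μ).ge) = θ :=
      RingHom.ext fun m => by
        rw [RingHom.comp_apply, RingHom.comp_apply, inclusion_le_inclusion_ge (muAlgValueField_galConj_complexConj μ)]
    rw [hcomp]
    exact (mem_bar_iff _ _).1 hθ

omit [IsCMField L] [IsGalois ℚ L] in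
/-- `ι(φ(x̄)) = \overline{ι(φ(x))}`: a `ℚ`-algebra map between CM fields followed by a complex embedding intertwines the CM involution of
`E` with complex conjugation. [folklore] -/
theorem apply_apply_complexConj_eq_conj (φ : E →ₐ[ℚ] L) (ι : L →+* ℂ) (y : E) :
    ι (φ (IsCMField.complexConj E y)) = starRingEnd ℂ (ι (φ y)) :=
  IsCMField.complexEmbedding_complexConj (K := E) (ι.comp (φ : E →+* L)) y

/-- **[Liu21, Def. 4.5 (1) for `μᶜ`]: `η_{μᶜ}(x) = \overline{η_μ(x)}`** for `x ∈ M_{μᶜ} = M_μ` (`\bar{·}` the CM involution of `E`), in the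
presentation `(L, φ, ι)` of `Def45AsPrinted`: `eta φ ι hμ.galConj ⟨x, _⟩ = IsCMField.complexConj E (eta φ ι hμ ⟨x, _⟩)`.  So the transported
datum `D_μ^{(c)}` (same complex points, `E`-structure twisted by `c`) satisfies Def. 4.5 (2)'s first bullet FOR `μᶜ`: `det(i(x) | Lie A^{(c)}) =
\overline{det(i(x) | Lie A)} = \overline{η_μ(x)} = η_{μᶜ}(x)`. [cite: Liu2021, Def. 4.5 (1) (TeX l. 1939–1942) and Remark 4.4 (ll. 1930–1933)]
[cite: Shimura1998, §18.5 (18.5b)] -/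
theorem eta_galConj_apply (φ : E →ₐ[ℚ] L) (ι : L →+* ℂ)
    {μ : Literature.NumberTheory.Automorphic.IdeleClassGroup E →ₜ* Circle} (hμ : IsConjugateSymplectic E μ)
    (x : ℂ) (hx : x ∈ muAlgValueField E μ) (hx' : x ∈ muAlgValueField E (galConj 𝔠 μ)) :
    eta φ ι hμ.galConj ⟨x, hx'⟩ = IsCMField.complexConj E (eta φ ι hμ ⟨x, hx⟩) := by
  haveI := hμ.numberField_muAlgValueField
  apply (φ : E →+* L).injective
  apply ι.injective
  change ι (φ (eta φ ι hμ.galConj ⟨x, hx'⟩)) = ι (φ (IsCMField.complexConj E (eta φ ι hμ ⟨x, hx⟩)))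
  rw [apply_apply_complexConj_eq_conj, apply_eta_eq_finprod φ ι hμ.galConj ⟨x, hx'⟩, apply_eta_eq_finprod φ ι hμ ⟨x, hx⟩,
    ← finprod_mem_bar_apply, coe_inducedCMType_galConj_eq_image φ ι hμ]
  have hinj : Set.InjOn (fun θ : ↥(muAlgValueField E μ) →+* ℂ =>
      θ.comp (Subfield.inclusion (muAlgValueField_galConj_complexConj μ).le))
      (bar (inducedCMType (incl φ ι hμ) (reflexCMType ι hμ.cmType φ))).1 := by
    intro θ₁ _ θ₂ _ h
    refine RingHom.ext fun m => ?_
    have hm := RingHom.congr_fun h (Subfield.inclusion (muAlgValueField_galConj_complexConj μ).ge m)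
    simp only [RingHom.coe_comp, Function.comp_apply] at hm
    have hmm : Subfield.inclusion (muAlgValueField_galConj_complexConj μ).le
        (Subfield.inclusion (muAlgValueField_galConj_complexConj μ).ge m) = m :=
      inclusion_le_inclusion_ge (muAlgValueField_galConj_complexConj μ) m
    rwa [hmm] at hm
  rw [finprod_mem_image hinj]
  exact finprod_mem_congr rfl fun θ _ => by
    rw [RingHom.comp_apply, inclusion_mk]

/-- Pointwise form on an element of `M_μ` (its membership in `M_{μᶜ}` supplied by `M_{μᶜ} = M_μ`).
[cite: Liu2021, Def. 4.5 (1) (TeX l. 1939–1942) and Remark 4.4 (ll. 1930–1933)] -/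
theorem eta_galConj_apply' (φ : E →ₐ[ℚ] L) (ι : L →+* ℂ)
    {μ : Literature.NumberTheory.Automorphic.IdeleClassGroup E →ₜ* Circle} (hμ : IsConjugateSymplectic E μ)
    (x : ↥(muAlgValueField E μ)) :
    eta φ ι hμ.galConj (Subfield.inclusion (muAlgValueField_galConj_complexConj μ).ge x) =
      IsCMField.complexConj E (eta φ ι hμ x) :=
  eta_galConj_apply φ ι hμ x x.2 _

/-- **As maps: `η_{μᶜ} ∘ (M_μ = M_{μᶜ}) = c_E ∘ η_μ`.** [cite: Liu2021, Def. 4.5 (1) (TeX l. 1939–1942) and Remark 4.4 (ll. 1930–1933)] -/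
theorem eta_galConj_comp_inclusion (φ : E →ₐ[ℚ] L) (ι : L →+* ℂ)
    {μ : Literature.NumberTheory.Automorphic.IdeleClassGroup E →ₜ* Circle} (hμ : IsConjugateSymplectic E μ) :
    (eta φ ι hμ.galConj).comp (Subfield.inclusion (muAlgValueField_galConj_complexConj μ).ge).toMonoidHom =
      ((IsCMField.complexConj E : E ≃ₐ[↥(maximalRealSubfield E)] E) : E →* E).comp (eta φ ι hμ) :=
  MonoidHom.ext fun x => eta_galConj_apply' φ ι hμ x

end Eta

end Summit.HodgeConjecture.CorCM.D2Bridge.AdapterRelabel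

end
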